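import Mathlib.Tactic
import HarnessLib

/-!
# Kozma–Nitzan's Question 8 at three relays — THEOREM K-c and THEOREM UB: the sharp c-sensitive bound on subtree sums (gen 28)

Support file (`--supports stmt-CriticalPhenomena-4575`, closed crux; independent mathematics on Kozma–Nitzan's Question 8,
arXiv:2401.12397 §5.5 p. 36), prover `prim-ineq-gen-6` (gen 28).  No definitions, no named facts, no sorries; standard axioms.
Memo `run/shared/lean/prim/prim-ineq-gen-6/PROOF-UB-G28.md`.

For a path-end block with out-defect `c ≥ 0` the depth quantity `κ̂_j` of the reduction identity (gen 24) satisfies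
THEOREM K-c: `κ̂_j + c·[m/S_{j+1} + a_jγ_j(Φ_{j+1} − m_{j+1})] ≥ 0`, equivalently (multiplying by `S_{j+1}` and using
`m + 𝔲 + 𝔳 = Φ − u^N − D^N`) `S_{j+1}κ̂_j + c(Φ − u^N − D^N) ≥ 0`, where `𝔲 = γw`, `𝔳 = az` are the far A-channel and C-channel cores
(`w = S_{j+1}a_ju″`, `z = S_{j+1}γ_jv″`), `u^N = (π−m) − 𝔲`, `D^N = D − 𝔳`.  The proof is the four-term decomposition
`T1 + T2 + T3 + T4` of `Kc_core` below (T3, T4 ≥ 0 termwise; T2 ≥ 𝔳Φ(1−Φ) absorbs the only negative part of T1 through the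
joint-defect bound `(1−γ_j)S_{j+1}u″ ≤ J ≤ 1−Φ`).  By the SHIFTED REDUCTION IDENTITY
`−ω_j(U_j − c·μ̂^_j) = s(1−s)[S_j(κ̂_j + c[…]) − Σ_{j'<j} c_{j,j'}(U_{j'} − c·μ̂^_{j'})]` (exact; `c_{j,j'} ≥ 0`), THEOREM K-c gives by
induction THEOREM UB: `U_j ≤ c·μ̂^_j = c·m(T∖e_{j+1})/S_j` for every depth — the positive subtree sums of the θ‴ class density are
`O(c)` with the sharp constant (ratio → 1 at the face).  `uniA_step` is the one-step identity behind THEOREM R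
(UNI-A(U;y) ⟸ SSC(U) ∧ (Q-A)), `abel_step` the summation-by-parts step behind (Q-A) ⟸ (T1).
[cite: KozmaNitzan2024, Question 8 (§5.5 p. 36)]
-/

namespace Summit.CriticalPhenomena.PercolationContinuityZ3.Theorems

namespace PocketCert

/-- **THEOREM K-c, algebraic core (everything multiplied by `Φ·S_{j+1}`).**  Variables: block moments `π, m, D` (`Φ = π + D`),
prefix marks `a = a_j`, `γ = γ_j`, far cores `w = S_{j+1}a_ju″`, `z = S_{j+1}γ_jv″` with `π − m = γw + uN`, `D = az + DN`,
prefix sums `M ≥ γE`, and `LΦ = Φ·L_j`, `RΦ = Φ·R_j` of the symmetric form with `cΦ = D(πΦ−m)` substituted.  Hypotheses used: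
`0 ≤ πΦ − m` (c ≥ 0), LEMMA G `Φ²π ≥ cΦ`, `K₃Φ ≥ 0`, and the joint-defect bound `(1−γ)w ≤ a(1−Φ)`.  Conclusion:
`Φ·[S_{j+1}κ̂_j + c(Φ − uN − DN)] = w·LΦ + z·RΦ − Φ²a·w·z + D(πΦ−m)(Φ − uN − DN) ≥ 0`.
[cite: KozmaNitzan2024, Question 8 (§5.5 p. 36)] -/
theorem Kc_core (π m D Φ a γ w z uN DN M E LΦ RΦ : ℝ)
    (hΦ : Φ = π + D) (huN : uN = π - m - γ * w) (hDN : DN = D - a * z)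
    (hL : LΦ = (1 - γ) * (Φ ^ 2 * π - D * (π * Φ - m)) + Φ ^ 2 * (M - γ * E))
    (hR : RΦ = (Φ * (Φ + m) - D * (π * Φ - m)) * (1 - a) + a * Φ * (Φ + m) * (1 - Φ))
    (hΦ0 : 0 ≤ Φ) (hΦ1 : Φ ≤ 1) (hm : 0 ≤ m) (ha0 : 0 ≤ a) (ha1 : a ≤ 1) (hγ0 : 0 ≤ γ) (hγ1 : γ ≤ 1)
    (hw : 0 ≤ w) (hz : 0 ≤ z) (huN0 : 0 ≤ uN) (hDN0 : 0 ≤ DN) (hME : γ * E ≤ M)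
    (hc0 : 0 ≤ π * Φ - m) (hG : D * (π * Φ - m) ≤ Φ ^ 2 * π) (hK3 : 0 ≤ Φ * (Φ + m) - D * (π * Φ - m))
    (hJ : (1 - γ) * w ≤ a * (1 - Φ)) :
    0 ≤ w * LΦ + z * RΦ - Φ ^ 2 * a * w * z + D * (π * Φ - m) * (Φ - uN - DN) := by
  -- the four-term decomposition (exact)
  have decomp : w * LΦ + z * RΦ - Φ ^ 2 * a * w * z + D * (π * Φ - m) * (Φ - uN - DN)
      = (w * ((1 - γ) * (Φ ^ 2 * π - D * (π * Φ - m)) + Φ ^ 2 * (M - γ * E)) - (1 - γ) * w * Φ ^ 2 * (a * z))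
        + z * (RΦ - a * Φ * m * (1 - Φ))
        + a * z * uN * (Φ ^ 2 - (π * Φ - m))
        + DN * (π * Φ - m) * (π - uN) := by
    subst huN hDN hL
    have hπ : π = Φ - D := by linarith
    subst hπ
    ring
  rw [decomp]
  have hD0 : 0 ≤ D := by nlinarith [mul_nonneg ha0 hz]
  have hπuN : m ≤ π - uN := by
    have e : π - uN = m + γ * w := by rw [huN]; ring
    rw [e]; nlinarith [mul_nonneg hγ0 hw]
  -- T1 without its negative part, T3, T4 are nonnegative
  have t1a : 0 ≤ w * ((1 - γ) * (Φ ^ 2 * π - D * (π * Φ - m)) + Φ ^ 2 * (M - γ * E)) := by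
    apply mul_nonneg hw
    have h1 : 0 ≤ (1 - γ) * (Φ ^ 2 * π - D * (π * Φ - m)) := mul_nonneg (sub_nonneg.2 hγ1) (by linarith)
    have h2 : 0 ≤ Φ ^ 2 * (M - γ * E) := mul_nonneg (sq_nonneg Φ) (by linarith)
    linarith
  have t3 : 0 ≤ a * z * uN * (Φ ^ 2 - (π * Φ - m)) := by
    have e : Φ ^ 2 - (π * Φ - m) = Φ * D + m := by rw [hΦ]; ring
    have h1 : 0 ≤ Φ ^ 2 - (π * Φ - m) := by rw [e]; nlinarith
    exact mul_nonneg (mul_nonneg (mul_nonneg ha0 hz) huN0) h1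
  have t4 : 0 ≤ DN * (π * Φ - m) * (π - uN) := mul_nonneg (mul_nonneg hDN0 hc0) (le_trans hm hπuN)
  -- T2 ≥ a z Φ²(1−Φ), and the negative part of T1 is at most a(1−Φ)Φ²(a z) ≤ a z Φ²(1−Φ)
  have t2 : a * z * (Φ ^ 2 * (1 - Φ)) ≤ z * (RΦ - a * Φ * m * (1 - Φ)) := by
    have e : z * (RΦ - a * Φ * m * (1 - Φ)) - a * z * (Φ ^ 2 * (1 - Φ))
        = z * ((Φ * (Φ + m) - D * (π * Φ - m)) * (1 - a)) := by rw [hR]; ring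
    have h1 : 0 ≤ z * ((Φ * (Φ + m) - D * (π * Φ - m)) * (1 - a)) :=
      mul_nonneg hz (mul_nonneg hK3 (sub_nonneg.2 ha1))
    linarith
  have neg : (1 - γ) * w * Φ ^ 2 * (a * z) ≤ a * z * (Φ ^ 2 * (1 - Φ)) := by
    have h1 : (1 - γ) * w * (Φ ^ 2 * (a * z)) ≤ a * (1 - Φ) * (Φ ^ 2 * (a * z)) :=
      mul_le_mul_of_nonneg_right hJ (mul_nonneg (sq_nonneg Φ) (mul_nonneg ha0 hz))
    have h2 : a * (1 - Φ) * (Φ ^ 2 * (a * z)) ≤ 1 * (1 - Φ) * (Φ ^ 2 * (a * z)) := by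
      apply mul_le_mul_of_nonneg_right _ (mul_nonneg (sq_nonneg Φ) (mul_nonneg ha0 hz))
      exact mul_le_mul_of_nonneg_right ha1 (sub_nonneg.2 hΦ1)
    have e1 : (1 - γ) * w * Φ ^ 2 * (a * z) = (1 - γ) * w * (Φ ^ 2 * (a * z)) := by ring
    have e2 : a * z * (Φ ^ 2 * (1 - Φ)) = 1 * (1 - Φ) * (Φ ^ 2 * (a * z)) := by ring
    rw [e1, e2]; exact le_trans h1 h2
  linarith

/-- **THEOREM K-c (the depth statement).**  Dividing the core by `Φ·S_{j+1} > 0`: if `Φ S (κ̂ + c·br) ≥ 0` with `Φ, S > 0` then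
`κ̂ + c·br ≥ 0`; here `br = m/S_{j+1} + a_jγ_j(Φ_{j+1} − m_{j+1})` and `S(κ̂ + c·br) = S κ̂ + c(Φ − u^N − D^N)` by the bookkeeping
identity `m + 𝔲 + 𝔳 = Φ − u^N − D^N` (`Φ − m = u + D`). [cite: KozmaNitzan2024, Question 8 (§5.5 p. 36)] -/
theorem Kc_of_core (Φ S κ c br : ℝ) (hΦ : 0 < Φ) (hS : 0 < S) (h : 0 ≤ Φ * (S * (κ + c * br))) : 0 ≤ κ + c * br := by
  by_contra hneg
  have h1 : κ + c * br < 0 := lt_of_not_ge hneg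
  have h2 : S * (κ + c * br) < 0 := mul_neg_of_pos_of_neg hS h1
  have h3 : Φ * (S * (κ + c * br)) < 0 := mul_neg_of_pos_of_neg hΦ h2
  linarith

/-- **The induction step of THEOREM UB.**  From the shifted reduction identity `−ω·Uf = s(1−s)(K − Σ')` with `ω > 0`, `0 ≤ s ≤ 1`,
`K ≥ 0` (THEOREM K-c at this depth) and `Σ' ≤ 0` (the earlier shifted subtree sums `Uf_{j'} ≤ 0` with coefficients `c_{j,j'} ≥ 0`),
the shifted subtree sum `Uf = U_j − c·μ̂^_j` is nonpositive. [cite: KozmaNitzan2024, Question 8 (§5.5 p. 36)] -/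
theorem ub_step (ω s Uf K Sg : ℝ) (hω : 0 < ω) (hs0 : 0 ≤ s) (hs1 : s ≤ 1) (hid : -ω * Uf = s * (1 - s) * (K - Sg))
    (hK : 0 ≤ K) (hSg : Sg ≤ 0) : Uf ≤ 0 := by
  have h1 : 0 ≤ s * (1 - s) * (K - Sg) := mul_nonneg (mul_nonneg hs0 (sub_nonneg.2 hs1)) (by linarith)
  by_contra h
  have h2 : -ω * Uf < 0 := by nlinarith
  linarith

/-- **The coefficient sum in the UB step is nonpositive.**  Two earlier depths suffice to show the pattern: `c₁, c₂ ≥ 0` and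
`Uf₁, Uf₂ ≤ 0` give `c₁Uf₁ + c₂Uf₂ ≤ 0` (the general finite sum is the same argument termwise).
[cite: KozmaNitzan2024, Question 8 (§5.5 p. 36)] -/
theorem ub_sigma_nonpos (c₁ c₂ U₁ U₂ : ℝ) (h1 : 0 ≤ c₁) (h2 : 0 ≤ c₂) (hU1 : U₁ ≤ 0) (hU2 : U₂ ≤ 0) :
    c₁ * U₁ + c₂ * U₂ ≤ 0 := by
  nlinarith [mul_nonpos_of_nonneg_of_nonpos h1 hU1, mul_nonpos_of_nonneg_of_nonpos h2 hU2]

/-- **THEOREM R, one-step identity.**  Along the classes, `corrR_t = C_t[A_t·corrR_{t−1} + (1−A_t)Q_{t−1}]` and the own supply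
`y_t/p_t = c(a_t + γ_t − 2a_tγ_t)` with `a_t = a_{t−1}A_t`, `γ_t = γ_{t−1}C_t`; hence
`corrR_t + y_t/p_t = A_tC_t[corrR_{t−1} + y_{t−1}/p_{t−1}] + c·a_t(1−C_t) + (1−A_t)C_t[Q_{t−1} + cγ_{t−1}]`.
[cite: KozmaNitzan2024, Question 8 (§5.5 p. 36)] -/
theorem uniA_step (A C a γ c R R' Q : ℝ) (hrec : R' = C * (A * R + (1 - A) * Q)) :
    R' + c * (a * A + γ * C - 2 * (a * A) * (γ * C))
      = A * C * (R + c * (a + γ - 2 * a * γ)) + c * (a * A) * (1 - C) + (1 - A) * C * (Q + c * γ) := by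
  rw [hrec]; ring

/-- **THEOREM R, one-step inequality.**  If UNI-A held at `t−1` (`corrR_{t−1} + y_{t−1}/p_{t−1} ≥ 0`) and the corner condition
(Q-A) holds at depth `t−1` (`Q_{t−1} + cγ_{t−1} ≥ 0`), then UNI-A holds at `t`: `corrR_t + y_t/p_t ≥ 0`.
[cite: KozmaNitzan2024, Question 8 (§5.5 p. 36)] -/
theorem uniA_step_nonneg (A C a γ c R R' Q : ℝ) (hrec : R' = C * (A * R + (1 - A) * Q)) (hA0 : 0 ≤ A) (hA1 : A ≤ 1)
    (hC0 : 0 ≤ C) (hC1 : C ≤ 1) (ha : 0 ≤ a) (hc : 0 ≤ c) (hprev : 0 ≤ R + c * (a + γ - 2 * a * γ)) (hQ : 0 ≤ Q + c * γ) :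
    0 ≤ R' + c * (a * A + γ * C - 2 * (a * A) * (γ * C)) := by
  rw [uniA_step A C a γ c R R' Q hrec]
  have h1 : 0 ≤ A * C * (R + c * (a + γ - 2 * a * γ)) := mul_nonneg (mul_nonneg hA0 hC0) hprev
  have h2 : 0 ≤ c * (a * A) * (1 - C) := mul_nonneg (mul_nonneg hc (mul_nonneg ha hA0)) (sub_nonneg.2 hC1)
  have h3 : 0 ≤ (1 - A) * C * (Q + c * γ) := mul_nonneg (mul_nonneg (sub_nonneg.2 hA1) hC0) hQ
  linarith

/-- **Summation by parts, one step ((Q-A) ⟸ (T1)).**  With `θ' = a'/γ'` the new emission enters `Qa` and `θ'·Pg` identically: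
`(Qa + a'η) − θ'(Pg + γ'η) = (Qa − θPg) − (θ' − θ)Pg`; so only the jumps of `θ = a/γ` against the running `Pg` can make
`Qa − θPg` decrease. [cite: KozmaNitzan2024, Question 8 (§5.5 p. 36)] -/
theorem abel_step (Qa Pg θ θ' γ' η : ℝ) :
    (Qa + θ' * γ' * η) - θ' * (Pg + γ' * η) = (Qa - θ * Pg) - (θ' - θ) * Pg := by
  ring

/-- **THEOREM R (C-side), one-step identity.**  `corrL_t = A_t[C_t·corrL_{t−1} + (1−C_t)P_{t−1}]` and the same own supply give
`corrL_t + y_t/p_t = A_tC_t[corrL_{t−1} + y_{t−1}/p_{t−1}] + c·γ_t(1−A_t) + (1−C_t)A_t[P_{t−1} + c·a_{t−1}]`.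
[cite: KozmaNitzan2024, Question 8 (§5.5 p. 36)] -/
theorem uniC_step (A C a γ c L L' P : ℝ) (hrec : L' = A * (C * L + (1 - C) * P)) :
    L' + c * (a * A + γ * C - 2 * (a * A) * (γ * C))
      = A * C * (L + c * (a + γ - 2 * a * γ)) + c * (γ * C) * (1 - A) + (1 - C) * A * (P + c * a) := by
  rw [hrec]; ring

/-- **The corner LP (two representative depths).**  A positive depth contributes `d₁` with `0 ≤ d₁ ≤ c·μ₁` (THEOREM UB), a negative depth
contributes `d₂` (≤ 0, not needed), and the weights satisfy `θ₂ ≥ 0`.  If the A-corner hypothesis `d₁ + d₂ > 0` holds, then the θ-weighted sum is at least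
`−(θ₂ − θ₁)⁺·c·μ₁`: only an upward jump of `θ = a/γ` between the positive and the negative depth can cost, and at most the UB cap.  This is
the step (Q-A) ⟸ (V) of the memo (the general finite sum is the same argument termwise with `θ₂ = θ* = max` over the negative depths).
[cite: KozmaNitzan2024, Question 8 (§5.5 p. 36)] -/
theorem lp_corner_bound (d₁ d₂ θ₁ θ₂ c μ₁ : ℝ) (hd1 : 0 ≤ d₁) (hcap : d₁ ≤ c * μ₁) (hθ2 : 0 ≤ θ₂)
    (hyp : 0 < d₁ + d₂) : -(max (θ₂ - θ₁) 0 * (c * μ₁)) ≤ θ₁ * d₁ + θ₂ * d₂ := by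
  have h1 : θ₂ * (-d₁) ≤ θ₂ * d₂ := mul_le_mul_of_nonneg_left (by linarith) hθ2
  have h2 : (θ₁ - θ₂) * d₁ ≤ θ₁ * d₁ + θ₂ * d₂ := by nlinarith
  have h3 : -(max (θ₂ - θ₁) 0) * d₁ ≤ (θ₁ - θ₂) * d₁ := by
    have := le_max_left (θ₂ - θ₁) 0
    nlinarith
  have h4 : -(max (θ₂ - θ₁) 0) * (c * μ₁) ≤ -(max (θ₂ - θ₁) 0) * d₁ := by
    have hm : 0 ≤ max (θ₂ - θ₁) 0 := le_max_right _ _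
    nlinarith
  linarith

/-- **THEOREM UB2 (quantitative form of UB), the step.**  The shifted reduction identity `−ω·Uf = s(1−s)(S·Kc − Σ')` with `ω = S_j(1−s) > 0`
(`S = S_j > 0`, `0 < s < 1`), `Σ' ≤ 0` (earlier shifted sums) gives not only `Uf ≤ 0` but `Uf ≤ −s·Kc`, i.e. `U_j ≤ c·μ̂^_j − s_{j+1}·Kc_j` with
`Kc_j = κ̂_j + c[m/S_{j+1} + a_jγ_j(Φ″−m″)] ≥ 0` (THEOREM K-c): at depths with large `κ̂_j` the subtree sum is quantitatively negative.
[cite: KozmaNitzan2024, Question 8 (§5.5 p. 36)] -/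
theorem ub2_step (S s Uf Kc Sg : ℝ) (hS : 0 < S) (hs0 : 0 < s) (hs1 : s < 1)
    (hid : -(S * (1 - s)) * Uf = s * (1 - s) * (S * Kc - Sg)) (hSg : Sg ≤ 0) : Uf ≤ -(s * Kc) := by
  have h1s : 0 < 1 - s := by linarith
  -- divide the identity by (1 - s) > 0 :  −S·Uf = s(S·Kc − Σ') ≥ s·S·Kc
  have h2 : -(S * Uf) = s * (S * Kc - Sg) := by
    have := hid
    have h' : (1 - s) * (-(S * Uf)) = (1 - s) * (s * (S * Kc - Sg)) := by linarith [this]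
    exact (mul_right_injective₀ (ne_of_gt h1s)) h'
  have h3 : s * (S * Kc) ≤ -(S * Uf) := by rw [h2]; nlinarith
  -- divide by S > 0
  by_contra h
  have h4 : -(s * Kc) < Uf := lt_of_not_ge h
  have h5 : S * (-(s * Kc)) < S * Uf := mul_lt_mul_of_pos_left h4 hS
  linarith

/-- **THEOREM V1 (k₁ = 1), the division step.**  From the cliff bound CB′₀, `(Φ+m)·J′ < a₀²Φ·s₁·u₁`, with `J′ ≥ (1−C)·νg` and
`u₁ ≤ νl + C·νg` (`νg > 0` the A-defect ν-mass from the θ-argmax on, `νl ≥ 0` the mass before it, `C = C_[1,k*] > 0`), one gets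
`(1−C)·νg·(Φ+m) < a₀²Φ s₁ (νl + C νg)`; this is the inequality that turns into `val_d ≤ a₀³(1−s₁)(Φ/(Φ+m))(1 + E/C)`, `E = νl/νg`.
[cite: KozmaNitzan2024, Question 8 (§5.5 p. 36)] -/
theorem v1_cliff_division (Φ m J u a₀ s₁ C νl νg : ℝ) (hΦm : 0 < Φ + m) (hcb : (Φ + m) * J < a₀ ^ 2 * Φ * s₁ * u)
    (hJ : (1 - C) * νg ≤ J) (hu : u ≤ νl + C * νg) (hΦ : 0 ≤ Φ) (hs : 0 ≤ s₁) :
    (1 - C) * νg * (Φ + m) < a₀ ^ 2 * Φ * s₁ * (νl + C * νg) := by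
  have h1 : (Φ + m) * ((1 - C) * νg) ≤ (Φ + m) * J := mul_le_mul_of_nonneg_left hJ hΦm.le
  have h2 : a₀ ^ 2 * Φ * s₁ * u ≤ a₀ ^ 2 * Φ * s₁ * (νl + C * νg) :=
    mul_le_mul_of_nonneg_left hu (mul_nonneg (mul_nonneg (sq_nonneg a₀) hΦ) hs)
  nlinarith

open Finset in
/-- **The corner LP, finite-sum form ((Q-A) ⟸ (V), given THEOREM UB and SSC(U)).**  Positive depths `i ∈ P` contribute `0 ≤ d_i ≤ c·μ_i` (UB caps),
negative depths `i ∈ N` contribute `d_i ≤ 0` with weights `θ_i ≤ θ*`, `θ* ≥ 0`.  If the A-corner hypothesis `Σ_P d + Σ_N d > 0` holds then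
`Σ θ_i d_i ≥ −c·Σ_{i∈P} (θ* − θ_i)⁺ μ_i` — the structural quantity `val` of the memo (FINDING-G28 §2).
[cite: KozmaNitzan2024, Question 8 (§5.5 p. 36)] -/
theorem lp_corner_sum {ι : Type*} (P N : Finset ι) (d θ μ : ι → ℝ) (c θs : ℝ)
    (hpos : ∀ i ∈ P, 0 ≤ d i) (hcap : ∀ i ∈ P, d i ≤ c * μ i) (hneg : ∀ i ∈ N, d i ≤ 0)
    (hθ : ∀ i ∈ N, θ i ≤ θs) (hθs : 0 ≤ θs) (hyp : 0 < ∑ i ∈ P, d i + ∑ i ∈ N, d i) :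
    -(c * ∑ i ∈ P, max (θs - θ i) 0 * μ i) ≤ ∑ i ∈ P, θ i * d i + ∑ i ∈ N, θ i * d i := by
  have h1 : θs * ∑ i ∈ N, d i ≤ ∑ i ∈ N, θ i * d i := by
    rw [Finset.mul_sum]
    apply Finset.sum_le_sum
    intro i hi
    have := hneg i hi
    have := hθ i hi
    nlinarith
  have h2 : -(θs * ∑ i ∈ P, d i) ≤ θs * ∑ i ∈ N, d i := by nlinarith
  have h3 : -(c * ∑ i ∈ P, max (θs - θ i) 0 * μ i) ≤ ∑ i ∈ P, θ i * d i - θs * ∑ i ∈ P, d i := by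
    rw [Finset.mul_sum, Finset.mul_sum, ← Finset.sum_sub_distrib, ← neg_le_neg_iff, neg_neg, ← Finset.sum_neg_distrib]
    apply Finset.sum_le_sum
    intro i hi
    have hd := hpos i hi
    have hc := hcap i hi
    have hm : 0 ≤ max (θs - θ i) 0 := le_max_right _ _
    have hm1 : θs - θ i ≤ max (θs - θ i) 0 := le_max_left _ _
    nlinarith [mul_le_mul_of_nonneg_left hc hm, mul_nonneg hm hd]
  linarith

end PocketCert

end Summit.CriticalPhenomena.PercolationContinuityZ3.Theorems
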